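import Summits.AtomisticToContinuum.HydrodynamicLimit.Theses.BoxDissipativeWeakStrong
import Literature.Analysis.FluidPDE.HardSphereFlowJointMeasurable
import Literature.Analysis.FluidPDE.HardSphereDynamicsProofs
import Literature.MathematicalPhysics.KineticTheory.HardSphereEulerProofs
import Literature.Analysis.FunctionSpaces.TorusCalculusProofs
import Summits.AtomisticToContinuum.HydrodynamicLimit.Theorems.BoxDissipativeWeakStrongLocalGibbsFineScaleKernels
import HarnessLib

/-!
# `FluxClosure` (route `BoxDissipativeWeakStrong`, line birth), stub B4: the three box functionals
are integrable along the orbit of a good datum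

Support file for item stmt-AtomisticToContinuum-9902
(`Summit.AtomisticToContinuum.HydrodynamicLimit.Theses.BoxDissipativeWeakStrong.FluxClosure`). For a GOOD
datum `z` of the hard-sphere flow `Φ N` on `𝕋³` and a test field `w` smooth on the slab `[0,T) × 𝕋³`, the
frozen-time box functionals `Q(t) = ∫ (⟪m̂, ∂ₜw⟫ + (m̂⊗m̂/ρ̂):∇w + p_cut div w)`,
`R(t) = ∫ ρ̂θ̂ (Z_cut - 1) div w`, `S(t) = ∫ Σ_ij (Ŝ - m̂⊗m̂/ρ̂ - δ ρ̂θ̂)_ij ∂_j w_i` (box fields of `Φ_t z`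
at the cube kernel `K_ℓ(x,y) = ℓ⁻³ 𝟙[∀ i, ‖yᵢ - xᵢ‖ < ℓ/2]`) are integrable on `(0, τ]`, `τ < T`
(`stub_boxIntegrableAlongFlow`, from the generic `integrableOn_boxFunctionals`). Proof: integrable =
measurable + bounded on a set of finite measure (`integrableOn_Ioc_integral`). MEASURABLE: the orbit of a
good datum is measurable in `t` (`HardSphereFlow.measurable_flow_prod_torus`), the kernel is jointly
measurable (`LGFS.measurable_boxK_uncurry`), and `∂ₜw`, `∂ₖwⱼ` agree on the slab with evaluations of a
measurable field of continuous linear maps (`exists_measurable_fderiv`: `fderivWithin (stLift w) ([0,T) × ℝ³)`,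
continuous on the slab, extended by zero, read in the fundamental domain through `Torus.repr`). BOUNDED on
`[0, τ]`: the derivative fields are bounded on the compact `[0,τ] × [0,1]³`; `0 ≤ ρ̂ ≤ ℓ⁻³`, `‖m̂‖ ≤ V ρ̂`,
`Ê ≤ V² ρ̂`, `|Ŝᵢⱼ| ≤ V² ρ̂` with `V² = Σᵢ ‖vᵢ(0)‖²` (energy conservation), so `m̂ᵢm̂ⱼ/ρ̂` and
`θ̂ = ⅔(Ê/ρ̂ - |m̂|²/2ρ̂²)` are bounded (division by zero is zero), and `Z_cut(ρ̂σ³)` takes finitely many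
values since `ρ̂ ∈ {(N+1)⁻¹ ℓ⁻³ m : m ≤ N+1}` (the `deriv` inside `hsCompressibility` is arbitrary).
References: H. Spohn, *Large Scale Dynamics of Interacting Particles* (1991), Part I §3.2–3.3;
C. Cercignani, R. Illner, M. Pulvirenti (1994), §4.2.
-/

noncomputable section
namespace Summit.AtomisticToContinuum.HydrodynamicLimit.Theorems
namespace FluxClosureB4
open scoped BigOperators Topology Classical MeasureTheory ProbabilityTheory InnerProductSpace ENNReal
open Filter Set Function MeasureTheory
open Literature.MathematicalPhysics.KineticTheory Literature.Analysis.FluidPDE Literature.Analysis.FunctionSpaces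

variable {n : ℕ}

/-- Parametric integrals over the torus: if `F t x = G (t, x)` for `t ∈ [0, T)` with `G` jointly
measurable and bounded on `[0, τ] × 𝕋³`, `τ < T`, then `t ↦ ∫ F t x dx` is integrable on `(0, τ]`
(`StronglyMeasurable.integral_prod_right'`, `norm_integral_le_of_norm_le_const`). [folklore] -/
theorem integrableOn_Ioc_integral {F : ℝ → T3 → ℝ} {G : ℝ × T3 → ℝ} {τ T C : ℝ} (hτT : τ < T)
    (hG : Measurable G) (hFG : ∀ t ∈ Ico 0 T, ∀ x, F t x = G (t, x))
    (hC : ∀ p : ℝ × T3, p.1 ∈ Icc 0 τ → |G p| ≤ C) : IntegrableOn (fun t => ∫ x, F t x) (Ioc 0 τ) := by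
  have hgi : IntegrableOn (fun t => ∫ x, G (t, x)) (Ioc 0 τ) := by
    refine Measure.integrableOn_of_bounded (M := C) measure_Ioc_lt_top.ne
      (hG.stronglyMeasurable.integral_prod_right' (ν := volume)).measurable.aestronglyMeasurable ?_
    filter_upwards [ae_restrict_mem measurableSet_Ioc] with t ht
    have h := norm_integral_le_of_norm_le_const (μ := (volume : Measure T3)) (f := fun x => G (t, x))
      (C := C) (ae_of_all _ fun x => by rw [Real.norm_eq_abs]; exact hC (t, x) ⟨ht.1.le, ht.2⟩)
    rwa [probReal_univ, mul_one] at h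
  refine hgi.congr_fun (fun t ht => ?_) measurableSet_Ioc
  exact integral_congr_ae (ae_of_all _ fun x => (hFG t ⟨ht.1.le, lt_of_le_of_lt ht.2 hτT⟩ x).symm)

/-- Space derivatives of the slices of a space–time smooth field are evaluations of the space–time
derivative of the lift: `∂ₖ (w t · j) (proj y) = (D(stLift w)(t, y) (0, eₖ)) j` for `t ∈ [0, T)`. [folklore] -/
theorem partialDeriv_apply_proj {T : ℝ} {w : ℝ → T3 → V3} (hw : Torus.IsSmoothSpaceTimeOn (Ico 0 T) w)
    {t : ℝ} (ht : t ∈ Ico 0 T) (y : EuclideanSpace ℝ (Fin 3)) (k j : Fin 3) :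
    Torus.partialDeriv k (fun x => w t x j) (Torus.proj y) =
      (fderivWithin ℝ (Torus.stLift w) (Ico 0 T ×ˢ univ) (t, y)) (0, EuclideanSpace.single k 1) j := by
  set e : EuclideanSpace ℝ (Fin 3) := EuclideanSpace.single k 1 with he
  have h1 : HasFDerivWithinAt (Torus.stLift w) (fderivWithin ℝ (Torus.stLift w) (Ico 0 T ×ˢ univ) (t, y))
      (Ico 0 T ×ˢ univ) (t, y + (0 : ℝ) • e) := by
    rw [zero_smul, add_zero]
    exact (hw.differentiableOn (by simp) (t, y) (mk_mem_prod ht (mem_univ _))).hasFDerivWithinAt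
  have h2 : HasDerivWithinAt (fun s : ℝ => ((t, y + s • e) : ℝ × EuclideanSpace ℝ (Fin 3)))
      ((0 : ℝ), e) univ 0 := by
    refine HasDerivWithinAt.prodMk (hasDerivWithinAt_const _ _ _) ?_
    simpa using ((hasDerivWithinAt_id (0 : ℝ) univ).smul_const e).const_add y
  have h3 := h1.comp_hasDerivWithinAt (0 : ℝ) h2 (fun s _ => mk_mem_prod ht (mem_univ _))
  have h4 : HasDerivWithinAt (fun s : ℝ => (Torus.stLift w (t, y + s • e)) j)
      ((fderivWithin ℝ (Torus.stLift w) (Ico 0 T ×ˢ univ) (t, y) (0, e)) j) univ 0 := by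
    simpa [Function.comp_def] using
      (EuclideanSpace.proj j : V3 →L[ℝ] ℝ).hasFDerivAt.comp_hasDerivWithinAt (0 : ℝ) h3
  have h6 : (fun s : ℝ => w t (Torus.proj y + Torus.proj (s • e)) j) =
      fun s => (Torus.stLift w (t, y + s • e)) j := by
    funext s; rw [← Torus.proj_add]; rfl
  unfold Torus.partialDeriv Torus.lineDeriv
  rw [← he, h6]
  exact (h4.hasDerivAt Filter.univ_mem).deriv

/-- For a field `w` smooth on `[0,T) × 𝕋³` and `τ < T` there is a MEASURABLE field `H` of continuous
linear maps on `ℝ × 𝕋³` (the space–time derivative of the lift on the slab, extended by zero, read in the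
fundamental domain) whose evaluations give `∂ₜw` (one-sided within `[0,T)`) and `∂ₖwⱼ` on the slab, and
which is bounded on `[0, τ] × 𝕋³`. [folklore] -/
theorem exists_measurable_fderiv {T τ : ℝ} (hτT : τ < T) {w : ℝ → T3 → V3}
    (hw : Torus.IsSmoothSpaceTimeOn (Ico 0 T) w) :
    ∃ (H : ℝ × T3 → (ℝ × EuclideanSpace ℝ (Fin 3) →L[ℝ] V3)) (C : ℝ), Measurable H ∧
      (∀ t ∈ Ico 0 T, ∀ x, Torus.timeDerivWithin (Ico 0 T) w t x = H (t, x) (1, 0)) ∧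
      (∀ t ∈ Ico 0 T, ∀ x (k j : Fin 3),
        Torus.partialDeriv k (fun y => w t y j) x = H (t, x) (0, EuclideanSpace.single k 1) j) ∧
      (∀ t ∈ Icc 0 τ, ∀ x, ‖H (t, x)‖ ≤ C) := by
  set slab : Set (ℝ × EuclideanSpace ℝ (Fin 3)) := Ico 0 T ×ˢ univ with hslab
  have hcont : ContinuousOn (fderivWithin ℝ (Torus.stLift w) slab) slab :=
    hw.continuousOn_fderivWithin ((uniqueDiffOn_Ico 0 T).prod uniqueDiffOn_univ) (by simp)
  set Ht : ℝ × EuclideanSpace ℝ (Fin 3) → (ℝ × EuclideanSpace ℝ (Fin 3) →L[ℝ] V3) :=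
    slab.piecewise (fderivWithin ℝ (Torus.stLift w) slab) 0 with hHt
  have hHt_meas : Measurable Ht :=
    hcont.measurable_piecewise continuousOn_const (measurableSet_Ico.prod MeasurableSet.univ)
  have hHt_eq : ∀ t ∈ Ico 0 T, ∀ y, Ht (t, y) = fderivWithin ℝ (Torus.stLift w) slab (t, y) :=
    fun t ht y => Set.piecewise_eq_of_mem _ _ _ (mk_mem_prod ht (mem_univ _))
  obtain ⟨C, hC⟩ := (isCompact_Icc.prod (Torus.isCompact_toLp_image_pi_Icc (d := Fin 3))).exists_bound_of_continuousOn
    (f := fderivWithin ℝ (Torus.stLift w) slab)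
    (hcont.mono (prod_mono (Icc_subset_Ico_right hτT) (subset_univ _)) : ContinuousOn _ (Icc (0 : ℝ) τ ×ˢ _))
  refine ⟨fun p => Ht (p.1, Torus.repr p.2), C,
    hHt_meas.comp (measurable_fst.prodMk (Torus.measurable_repr.comp measurable_snd)), ?_, ?_, ?_⟩
  · intro t ht x
    dsimp only
    rw [hHt_eq t ht, ← hw.timeDerivWithin_apply_proj (uniqueDiffOn_Ico 0 T) ht (Torus.repr x), Torus.proj_repr]
  · intro t ht x k j
    dsimp only
    rw [hHt_eq t ht, ← partialDeriv_apply_proj hw ht (Torus.repr x) k j, Torus.proj_repr]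
  · intro t ht x
    dsimp only
    rw [hHt_eq t (Icc_subset_Ico_right hτT ht)]
    exact hC _ (mk_mem_prod ht (Torus.repr_mem_toLp_image_pi_Icc x))

/-- At a frozen configuration with speeds `≤ V`, for a test function `0 ≤ χ ≤ κ`:
`0 ≤ ρ̂ ≤ κ`, `‖m̂‖ ≤ V ρ̂`, `0 ≤ Ê ≤ V² ρ̂`. [folklore] -/
theorem boxAtoms_bounds (c : Config n (Fin 3) T3) {χ : T3 → ℝ} {kb Vb : ℝ} (h0 : ∀ y, 0 ≤ χ y)
    (hb : ∀ y, χ y ≤ kb) (hV : ∀ i, ‖(c i).2‖ ≤ Vb) :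
    (0 ≤ empiricalDensityField c χ ∧ empiricalDensityField c χ ≤ kb) ∧
      ‖empiricalMomentumField c χ‖ ≤ Vb * empiricalDensityField c χ ∧
      (0 ≤ empiricalEnergyField c χ ∧ empiricalEnergyField c χ ≤ Vb ^ 2 * empiricalDensityField c χ) := by
  have hn : (0 : ℝ) ≤ (n : ℝ)⁻¹ := inv_nonneg.2 (Nat.cast_nonneg _)
  rw [empiricalDensityField_eq_sum, empiricalMomentumField_eq_sum, empiricalEnergyField_eq_sum]
  refine ⟨⟨mul_nonneg hn (Finset.sum_nonneg fun i _ => h0 _), ?_⟩, ?_, ?_, ?_⟩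
  · calc (n : ℝ)⁻¹ * ∑ i, χ (c i).1 ≤ (n : ℝ)⁻¹ * ∑ _i : Fin n, kb :=
          mul_le_mul_of_nonneg_left (Finset.sum_le_sum fun i _ => hb _) hn
      _ = (n : ℝ) / n * kb := by
          rw [Finset.sum_const, Finset.card_univ, Fintype.card_fin, nsmul_eq_mul, ← mul_assoc, inv_mul_eq_div]
      _ ≤ kb := mul_le_of_le_one_left ((h0 0).trans (hb 0)) (div_self_le_one _)
  · rw [norm_smul, norm_inv, Real.norm_natCast, mul_left_comm]
    refine mul_le_mul_of_nonneg_left ((norm_sum_le _ _).trans ?_) hn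
    rw [Finset.mul_sum]
    refine Finset.sum_le_sum fun i _ => ?_
    rw [norm_smul, Real.norm_of_nonneg (h0 _), mul_comm Vb]
    exact mul_le_mul_of_nonneg_left (hV i) (h0 _)
  · exact mul_nonneg hn (Finset.sum_nonneg fun i _ => mul_nonneg (h0 _) (by positivity))
  · rw [mul_left_comm]
    refine mul_le_mul_of_nonneg_left ?_ hn
    rw [Finset.mul_sum]
    refine Finset.sum_le_sum fun i _ => ?_
    rw [mul_comm (Vb ^ 2)]
    refine mul_le_mul_of_nonneg_left ?_ (h0 _)
    have h : ‖(c i).2‖ ^ 2 ≤ Vb ^ 2 := pow_le_pow_left₀ (norm_nonneg _) (hV i) 2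
    linarith [sq_nonneg ‖(c i).2‖]

/-- `|Ŝᵢⱼ| ≤ V² ρ̂` when all speeds are `≤ V` and `0 ≤ χ`. [folklore] -/
theorem abs_stress_le' (c : Config n (Fin 3) T3) {χ : T3 → ℝ} (h0 : ∀ y, 0 ≤ χ y)
    {Vb : ℝ} (hV : ∀ i, ‖(c i).2‖ ≤ Vb) (i j : Fin 3) :
    |∫ y, χ y.1 * (y.2 i * y.2 j) ∂(empiricalMeasure c)| ≤ Vb ^ 2 * empiricalDensityField c χ := by
  rw [integral_empiricalMeasure, empiricalDensityField_eq_sum, abs_mul,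
    abs_of_nonneg (inv_nonneg.2 (Nat.cast_nonneg _)), mul_left_comm]
  refine mul_le_mul_of_nonneg_left ((Finset.abs_sum_le_sum_abs _ _).trans ?_) (inv_nonneg.2 (Nat.cast_nonneg _))
  rw [Finset.mul_sum]
  refine Finset.sum_le_sum fun a _ => ?_
  rw [abs_mul, abs_of_nonneg (h0 _), abs_mul, mul_comm (Vb ^ 2)]
  refine mul_le_mul_of_nonneg_left ?_ (h0 _)
  have hi : |(c a).2 i| ≤ Vb := le_trans (by simpa using PiLp.norm_apply_le (c a).2 i) (hV a)
  have hj : |(c a).2 j| ≤ Vb := le_trans (by simpa using PiLp.norm_apply_le (c a).2 j) (hV a)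
  calc |(c a).2 i| * |(c a).2 j| ≤ Vb * Vb := mul_le_mul hi hj (abs_nonneg _) ((abs_nonneg _).trans hi)
    _ = Vb ^ 2 := (sq Vb).symm

/-- For a two-valued test function `χ ∈ {0, κ}`, `ρ̂ ∈ {n⁻¹ m κ : m ≤ n}`, so any function of `ρ̂` is
bounded by finitely many of its values. [folklore] -/
theorem abs_apply_empiricalDensityField_le (g : ℝ → ℝ) (c : Config n (Fin 3) T3) {χ : T3 → ℝ} {kb : ℝ}
    (hv : ∀ y, χ y = 0 ∨ χ y = kb) :
    |g (empiricalDensityField c χ)| ≤ ∑ m ∈ Finset.range (n + 1), |g ((n : ℝ)⁻¹ * (m * kb))| := by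
  have key : ∀ a, χ (c a).1 = if χ (c a).1 = kb then kb else 0 := fun a => by
    rcases hv (c a).1 with h | h
    · rw [h]; split_ifs with h' <;> [exact h'; rfl]
    · rw [h, if_pos rfl]
  have hm : (Finset.univ.filter fun a : Fin n => χ (c a).1 = kb).card ∈ Finset.range (n + 1) := by
    rw [Finset.mem_range, Nat.lt_succ_iff]
    exact (Finset.card_filter_le _ _).trans (by simp)
  have h : empiricalDensityField c χ =
      (n : ℝ)⁻¹ * ((Finset.univ.filter fun a : Fin n => χ (c a).1 = kb).card * kb) := by
    rw [empiricalDensityField_eq_sum, Finset.sum_congr rfl fun a _ => key a, Finset.sum_ite,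
      Finset.sum_const_zero, add_zero, Finset.sum_const, nsmul_eq_mul]
  rw [h]
  exact Finset.single_le_sum (f := fun m : ℕ => |g ((n : ℝ)⁻¹ * (m * kb))|) (fun _ _ => abs_nonneg _) hm

/-- The quotient `m̂ᵢ m̂ⱼ / ρ̂` is bounded: `|mᵢ mⱼ / r| ≤ V² κ` if `‖m‖ ≤ V r`, `0 ≤ r ≤ κ`
(division by zero is zero). [folklore] -/
theorem abs_mul_div_le {r kb Vb : ℝ} {m : V3} (hr0 : 0 ≤ r) (hrk : r ≤ kb) (hm : ‖m‖ ≤ Vb * r)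
    (i j : Fin 3) : |m i * m j / r| ≤ Vb ^ 2 * kb := by
  rcases hr0.eq_or_lt with h | h
  · rw [← h, div_zero, abs_zero]
    exact mul_nonneg (sq_nonneg _) (h.le.trans hrk)
  · have hi : |m i| ≤ ‖m‖ := by simpa using PiLp.norm_apply_le m i
    have hj : |m j| ≤ ‖m‖ := by simpa using PiLp.norm_apply_le m j
    rw [abs_div, abs_mul, abs_of_pos h, div_le_iff₀ h]
    calc |m i| * |m j| ≤ ‖m‖ * ‖m‖ := mul_le_mul hi hj (abs_nonneg _) (norm_nonneg _)
      _ ≤ (Vb * r) * (Vb * r) := mul_le_mul hm hm (norm_nonneg _) ((norm_nonneg _).trans hm)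
      _ = Vb ^ 2 * r * r := by ring
      _ ≤ Vb ^ 2 * kb * r := by gcongr

/-- The box temperature is bounded: `|⅔ (E/r - ‖m‖²/(2r²))| ≤ V²` if `‖m‖ ≤ V r`, `0 ≤ E ≤ V² r`,
`0 ≤ r` (division by zero is zero). [folklore] -/
theorem abs_boxTemp_le {r E Vb : ℝ} {m : V3} (hr0 : 0 ≤ r) (hm : ‖m‖ ≤ Vb * r) (hE0 : 0 ≤ E)
    (hE : E ≤ Vb ^ 2 * r) : |2 / 3 * (E / r - ‖m‖ ^ 2 / (2 * r ^ 2))| ≤ Vb ^ 2 := by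
  rcases hr0.eq_or_lt with h | h
  · rw [← h]; simp; positivity
  · have h1 : |E / r| ≤ Vb ^ 2 := by
      rw [abs_div, abs_of_nonneg hE0, abs_of_pos h, div_le_iff₀ h]; exact hE
    have h2 : |‖m‖ ^ 2 / (2 * r ^ 2)| ≤ Vb ^ 2 / 2 := by
      rw [abs_of_nonneg (by positivity), div_le_iff₀ (by positivity)]
      calc ‖m‖ ^ 2 ≤ (Vb * r) ^ 2 := pow_le_pow_left₀ (norm_nonneg _) hm 2
        _ = Vb ^ 2 / 2 * (2 * r ^ 2) := by ring
    calc |2 / 3 * (E / r - ‖m‖ ^ 2 / (2 * r ^ 2))| = 2 / 3 * |E / r - ‖m‖ ^ 2 / (2 * r ^ 2)| := by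
          rw [abs_mul, abs_of_pos (by norm_num : (0 : ℝ) < 2 / 3)]
      _ ≤ 2 / 3 * (|E / r| + |‖m‖ ^ 2 / (2 * r ^ 2)|) := by gcongr; exact abs_sub _ _
      _ ≤ 2 / 3 * (Vb ^ 2 + Vb ^ 2 / 2) := by gcongr
      _ = Vb ^ 2 := by ring

/-- **Main lemma.** Along a measurable configuration path `γ` with speeds `≤ V`, for a jointly
measurable two-valued box kernel `0 ≤ k ≤ κ` and a test field `w` smooth on `[0,T) × 𝕋³`, the three
box functionals `Q`, `R`, `S` of the momentum balance are integrable on `(0, τ]`, `τ < T`. [folklore] -/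
theorem integrableOn_boxFunctionals {γ : ℝ → Config n (Fin 3) T3} (hγ : Measurable γ) {Vb : ℝ}
    (hVb : 0 ≤ Vb) (hV : ∀ t i, ‖(γ t i).2‖ ≤ Vb) {k : T3 → T3 → ℝ}
    (hk : Measurable fun p : T3 × T3 => k p.1 p.2) {kb : ℝ} (hk0 : ∀ x y, 0 ≤ k x y)
    (hkb : ∀ x y, k x y ≤ kb) (hkv : ∀ x y, k x y = 0 ∨ k x y = kb) {T τ : ℝ} (hτT : τ < T)
    {w : ℝ → T3 → V3} (hw : Torus.IsSmoothSpaceTimeOn (Ico 0 T) w) (σ η₁ : ℝ) :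
    IntegrableOn (fun t => ∫ x, (inner ℝ (empiricalMomentumField (γ t) (k x)) (Torus.timeDerivWithin (Ico 0 T) w t x) + (∑ i, ∑ j, empiricalMomentumField (γ t) (k x) i * empiricalMomentumField (γ t) (k x) j / empiricalDensityField (γ t) (k x) * Torus.partialDeriv j (fun y => w t y i) x) + empiricalDensityField (γ t) (k x) * (2 / 3 * (empiricalEnergyField (γ t) (k x) / empiricalDensityField (γ t) (k x) - ‖empiricalMomentumField (γ t) (k x)‖ ^ 2 / (2 * empiricalDensityField (γ t) (k x) ^ 2))) * hsCompressibility (min (empiricalDensityField (γ t) (k x) * σ ^ 3) η₁) * Torus.divergence (w t) x)) (Ioc 0 τ) ∧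
    IntegrableOn (fun t => ∫ x, empiricalDensityField (γ t) (k x) * (2 / 3 * (empiricalEnergyField (γ t) (k x) / empiricalDensityField (γ t) (k x) - ‖empiricalMomentumField (γ t) (k x)‖ ^ 2 / (2 * empiricalDensityField (γ t) (k x) ^ 2))) * (hsCompressibility (min (empiricalDensityField (γ t) (k x) * σ ^ 3) η₁) - 1) * Torus.divergence (w t) x) (Ioc 0 τ) ∧
    IntegrableOn (fun t => ∫ x, ∑ i, ∑ j, ((∫ y, k x y.1 * (y.2 i * y.2 j) ∂(empiricalMeasure (γ t))) - empiricalMomentumField (γ t) (k x) i * empiricalMomentumField (γ t) (k x) j / empiricalDensityField (γ t) (k x) - (if i = j then empiricalDensityField (γ t) (k x) * (2 / 3 * (empiricalEnergyField (γ t) (k x) / empiricalDensityField (γ t) (k x) - ‖empiricalMomentumField (γ t) (k x)‖ ^ 2 / (2 * empiricalDensityField (γ t) (k x) ^ 2))) else 0)) * Torus.partialDeriv j (fun y => w t y i) x) (Ioc 0 τ) := by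
  obtain ⟨H, C, hHm, hHt, hHs, hHC⟩ := exists_measurable_fderiv hτT hw
  -- three scalar inequalities (kept local: generic statements)
  have abs_mul_le_mul : ∀ {a b A B : ℝ}, |a| ≤ A → |b| ≤ B → |a * b| ≤ A * B := fun ha hb => by
    rw [abs_mul]; exact mul_le_mul ha hb (abs_nonneg _) ((abs_nonneg _).trans ha)
  have abs_sum_sum_le : ∀ {f : Fin 3 → Fin 3 → ℝ} {c : ℝ}, (∀ i j, |f i j| ≤ c) → |∑ i, ∑ j, f i j| ≤ 9 * c :=
    fun h => ((Finset.abs_sum_le_sum_abs _ _).trans (Finset.sum_le_sum fun i _ =>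
      (Finset.abs_sum_le_sum_abs _ _).trans (Finset.sum_le_sum fun j _ => h i j))).trans (by simp; linarith)
  have abs_sum_le : ∀ {f : Fin 3 → ℝ} {c : ℝ}, (∀ i, |f i| ≤ c) → |∑ i, f i| ≤ 3 * c := fun h =>
    ((Finset.abs_sum_le_sum_abs _ _).trans (Finset.sum_le_sum fun i _ => h i)).trans (by simp)
  obtain ⟨D, hD⟩ : ∃ D : ℝ × T3 → ℝ, D = fun p => empiricalDensityField (γ p.1) (k p.2) := ⟨_, rfl⟩
  obtain ⟨M, hM⟩ : ∃ M : ℝ × T3 → V3, M = fun p => empiricalMomentumField (γ p.1) (k p.2) := ⟨_, rfl⟩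
  obtain ⟨E, hE⟩ : ∃ E : ℝ × T3 → ℝ, E = fun p => empiricalEnergyField (γ p.1) (k p.2) := ⟨_, rfl⟩
  obtain ⟨S, hS⟩ : ∃ S : Fin 3 → Fin 3 → ℝ × T3 → ℝ,
      S = fun i j p => ∫ y, k p.2 y.1 * (y.2 i * y.2 j) ∂(empiricalMeasure (γ p.1)) := ⟨_, rfl⟩
  obtain ⟨Z, hZ⟩ : ∃ Z : ℝ × T3 → ℝ, Z = fun p => hsCompressibility (min (D p * σ ^ 3) η₁) := ⟨_, rfl⟩
  obtain ⟨A, hA⟩ : ∃ A : ℝ × T3 → V3, A = fun p => H p (1, 0) := ⟨_, rfl⟩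
  obtain ⟨B, hB⟩ : ∃ B : Fin 3 → Fin 3 → ℝ × T3 → ℝ,
      B = fun a b p => H p (0, EuclideanSpace.single a 1) b := ⟨_, rfl⟩
  have hq : ∀ i, Measurable fun p : ℝ × T3 => k p.2 ((γ p.1) i).1 := fun i =>
    hk.comp (measurable_snd.prodMk ((measurable_pi_apply i).comp (hγ.comp measurable_fst)).fst)
  have hv : ∀ i, Measurable fun p : ℝ × T3 => ((γ p.1) i).2 := fun i =>
    ((measurable_pi_apply i).comp (hγ.comp measurable_fst)).snd
  have hvc : ∀ a i, Measurable fun p : ℝ × T3 => ((γ p.1) a).2 i := fun a i =>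
    (show Measurable fun v : V3 => v i by fun_prop).comp (hv a)
  have mD : Measurable D := by
    rw [hD]; simp only [empiricalDensityField_eq_sum]
    exact measurable_const.mul (Finset.measurable_sum _ fun i _ => hq i)
  have mM : Measurable M := by
    rw [hM]; simp only [empiricalMomentumField_eq_sum]
    exact Measurable.const_smul (Finset.measurable_sum Finset.univ fun i _ => (hq i).smul (hv i)) ((n : ℝ)⁻¹)
  have mE : Measurable E := by
    rw [hE]; simp only [empiricalEnergyField_eq_sum]
    exact measurable_const.mul (Finset.measurable_sum _ fun i _ => (hq i).mul (((hv i).norm.pow_const 2).div_const 2))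
  have mS : ∀ i j, Measurable (S i j) := fun i j => by
    rw [hS]; simp only [integral_empiricalMeasure]
    exact measurable_const.mul (Finset.measurable_sum _ fun a _ => (hq a).mul ((hvc a i).mul (hvc a j)))
  have mhs : Measurable hsCompressibility := measurable_const.add (measurable_id.mul (measurable_deriv _))
  have mZ : Measurable Z := hZ ▸ mhs.comp ((mD.mul_const _).min measurable_const)
  have mA : Measurable A := hA ▸ hHm.apply_continuousLinearMap _
  have mB : ∀ a b, Measurable (B a b) := fun a b => by
    rw [hB]
    exact (show Measurable fun v : V3 => v b by fun_prop).comp (hHm.apply_continuousLinearMap _)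
  have mMi : ∀ i, Measurable fun p => M p i := fun i =>
    (show Measurable fun v : V3 => v i by fun_prop).comp mM
  have hkb0 : 0 ≤ kb := (hk0 0 0).trans (hkb 0 0)
  have bAt : ∀ p, (0 ≤ D p ∧ D p ≤ kb) ∧ ‖M p‖ ≤ Vb * D p ∧ (0 ≤ E p ∧ E p ≤ Vb ^ 2 * D p) := fun p => by
    rw [hD, hM, hE]; exact boxAtoms_bounds (γ p.1) (hk0 p.2) (hkb p.2) (hV p.1)
  have bS : ∀ i j p, |S i j p| ≤ Vb ^ 2 * kb := fun i j p => by
    rw [hS]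
    exact (abs_stress_le' _ (hk0 _) (hV _) i j).trans (mul_le_mul_of_nonneg_left
      (boxAtoms_bounds (γ p.1) (hk0 p.2) (hkb p.2) (hV p.1)).1.2 (sq_nonneg _))
  obtain ⟨Zb, bZ⟩ : ∃ Zb : ℝ, ∀ p, |Z p| ≤ Zb := by
    refine ⟨∑ m ∈ Finset.range (n + 1), |hsCompressibility (min ((n : ℝ)⁻¹ * (m * kb) * σ ^ 3) η₁)|,
      fun p => ?_⟩
    rw [hZ, hD]
    exact abs_apply_empiricalDensityField_le (fun r => hsCompressibility (min (r * σ ^ 3) η₁)) (γ p.1) (hkv p.2)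
  have bA : ∀ p : ℝ × T3, p.1 ∈ Icc 0 τ → ‖A p‖ ≤ C := fun p hp => by
    have h := (H p).le_of_opNorm_le (hHC p.1 hp p.2) ((1 : ℝ), (0 : EuclideanSpace ℝ (Fin 3)))
    rw [show ‖((1 : ℝ), (0 : EuclideanSpace ℝ (Fin 3)))‖ = 1 by simp [Prod.norm_def], mul_one] at h
    rw [hA]; exact h
  have bB : ∀ a b (p : ℝ × T3), p.1 ∈ Icc 0 τ → |B a b p| ≤ C := fun a b p hp => by
    have h := (H p).le_of_opNorm_le (hHC p.1 hp p.2) ((0 : ℝ), EuclideanSpace.single a (1 : ℝ))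
    rw [show ‖((0 : ℝ), EuclideanSpace.single a (1 : ℝ))‖ = 1 by simp [Prod.norm_def], mul_one] at h
    rw [hB]; exact le_trans (by simpa using PiLp.norm_apply_le (H p (0, EuclideanSpace.single a 1)) b) h
  have bTh : ∀ p, |D p * (2 / 3 * (E p / D p - ‖M p‖ ^ 2 / (2 * D p ^ 2)))| ≤ kb * Vb ^ 2 := fun p =>
    abs_mul_le_mul (by rw [abs_of_nonneg (bAt p).1.1]; exact (bAt p).1.2)
      (abs_boxTemp_le (bAt p).1.1 (bAt p).2.1 (bAt p).2.2.1 (bAt p).2.2.2)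
  have bQ : ∀ p i j, |M p i * M p j / D p| ≤ Vb ^ 2 * kb := fun p i j =>
    abs_mul_div_le (bAt p).1.1 (bAt p).1.2 (bAt p).2.1 i j
  have eQ : ∀ t ∈ Ico 0 T, ∀ x, Torus.timeDerivWithin (Ico 0 T) w t x = A (t, x) := fun t ht x => by
    rw [hA, hHt t ht x]
  have eB : ∀ t ∈ Ico 0 T, ∀ x (a b : Fin 3), Torus.partialDeriv a (fun y => w t y b) x = B a b (t, x) :=
    fun t ht x a b => by rw [hB, hHs t ht x a b]
  have eDiv : ∀ t ∈ Ico 0 T, ∀ x, Torus.divergence (w t) x = ∑ i, B i i (t, x) := fun t ht x => by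
    simp only [Torus.divergence, eB t ht x]
  refine ⟨?_, ?_, ?_⟩
  · refine integrableOn_Ioc_integral hτT
      (G := fun p => ⟪M p, A p⟫_ℝ + (∑ i, ∑ j, M p i * M p j / D p * B j i p) +
        D p * (2 / 3 * (E p / D p - ‖M p‖ ^ 2 / (2 * D p ^ 2))) * Z p * ∑ i, B i i p)
      (C := Vb * kb * C + 9 * (Vb ^ 2 * kb * C) + kb * Vb ^ 2 * Zb * (3 * C)) (by fun_prop) ?_ ?_
    · intro t ht x
      rw [eQ t ht x, eDiv t ht x]
      simp only [eB t ht x, hD, hM, hE, hZ]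
    · intro p hp
      refine (abs_add_three _ _ _).trans (add_le_add_three ?_ ?_ ?_)
      · exact (abs_real_inner_le_norm _ _).trans (mul_le_mul (((bAt p).2.1).trans
          (mul_le_mul_of_nonneg_left (bAt p).1.2 hVb)) (bA p hp) (norm_nonneg _) (mul_nonneg hVb hkb0))
      · exact abs_sum_sum_le fun i j => abs_mul_le_mul (bQ p i j) (bB j i p hp)
      · exact abs_mul_le_mul (abs_mul_le_mul (bTh p) (bZ p)) (abs_sum_le fun i => bB i i p hp)
  · refine integrableOn_Ioc_integral hτT
      (G := fun p => D p * (2 / 3 * (E p / D p - ‖M p‖ ^ 2 / (2 * D p ^ 2))) * (Z p - 1) * ∑ i, B i i p)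
      (C := kb * Vb ^ 2 * (Zb + 1) * (3 * C)) (by fun_prop) ?_ ?_
    · intro t ht x
      rw [eDiv t ht x]
      simp only [hD, hM, hE, hZ]
    · intro p hp
      have hZ1 : |Z p - 1| ≤ Zb + 1 := (abs_sub _ _).trans (add_le_add (bZ p) (by simp))
      exact abs_mul_le_mul (abs_mul_le_mul (bTh p) hZ1) (abs_sum_le fun i => bB i i p hp)
  · refine integrableOn_Ioc_integral hτT
      (G := fun p => ∑ i, ∑ j, (S i j p - M p i * M p j / D p -
        (if i = j then D p * (2 / 3 * (E p / D p - ‖M p‖ ^ 2 / (2 * D p ^ 2))) else 0)) * B j i p)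
      (C := 9 * ((Vb ^ 2 * kb + Vb ^ 2 * kb + kb * Vb ^ 2) * C)) ?_ ?_ ?_
    · refine Finset.measurable_sum _ fun i _ => Finset.measurable_sum _ fun j _ => ?_
      have hSij := mS i j
      have hMi := mMi i
      have hMj := mMi j
      have hBji := mB j i
      split_ifs <;> fun_prop
    · intro t ht x
      simp only [eB t ht x, hD, hM, hE, hS]
    · intro p hp
      refine abs_sum_sum_le fun i j => abs_mul_le_mul ?_ (bB j i p hp)
      have hd : |(if i = j then D p * (2 / 3 * (E p / D p - ‖M p‖ ^ 2 / (2 * D p ^ 2))) else 0)| ≤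
          kb * Vb ^ 2 := by
        split_ifs
        · exact bTh p
        · rw [abs_zero]; exact mul_nonneg hkb0 (sq_nonneg _)
      exact ((abs_sub _ _).trans (add_le_add ((abs_sub _ _).trans (add_le_add (bS i j p) (bQ p i j))) hd))

/-- Along a good orbit every speed is bounded by the conserved kinetic energy:
`‖vᵢ(t)‖ ≤ (Σⱼ ‖vⱼ(0)‖²)^{1/2}` (`IsHardSphereTrajectory.configEnergy_eq_holds`). [folklore] -/
theorem norm_vel_flow_le {ε : ℝ} (Φ : HardSphereFlow (Torus.geometry (Fin 3)) ε n)
    {z : Config n (Fin 3) T3} (hz : z ∈ Φ.good) (t : ℝ) (i : Fin n) :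
    ‖(Φ.flow t z i).2‖ ≤ Real.sqrt (∑ j, ‖(z j).2‖ ^ 2) := by
  have hE : ∑ j, ‖(Φ.flow t z j).2‖ ^ 2 = ∑ j, ‖(z j).2‖ ^ 2 := by
    have h := IsHardSphereTrajectory.configEnergy_eq_holds (Φ.isTrajectory z hz) t 0
    simp only [Φ.flow_zero z hz, configEnergy] at h
    linarith
  refine Real.le_sqrt_of_sq_le ?_
  rw [← hE]
  exact Finset.single_le_sum (f := fun j => ‖(Φ.flow t z j).2‖ ^ 2) (fun j _ => sq_nonneg _)
    (Finset.mem_univ i)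

/-- **Stub B4** (`stub_boxIntegrableAlongFlow`): INTEGRABILITY OF THE THREE BOX FUNCTIONALS ALONG THE
ORBIT OF A GOOD DATUM. For a good datum `z` of `Φ N`, a window `ℓ N ∈ (0, 1]`, `τ ∈ [0, T)` and a test
field `w` smooth on `[0,T) × 𝕋³`, the frozen-time box functionals `Q`, `R`, `S` of the box momentum balance
(box fields `ρ̂, m̂, Ê, Ŝ` of `Φ_t z` at the cube kernel of side `ℓ N`, `θ̂ = ⅔(Ê/ρ̂ - |m̂|²/2ρ̂²)`,
`Z_cut(η) = Z(min η η₁)`, `p_cut = ρ̂θ̂Z_cut(ρ̂σ³)`) are integrable on `(0, τ]`: `integrableOn_boxFunctionals`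
along the measurable orbit `t ↦ Φ_t z` (`HardSphereFlow.measurable_flow_prod_torus`) with speeds bounded by
energy conservation (`norm_vel_flow_le`) and the cube kernel (`LGFS.*boxK*`, values in `{0, ℓ⁻³}`). [folklore] -/
theorem stub_boxIntegrableAlongFlow : ∀ (σ η₁ T : ℝ) (Φ : (N : ℕ) → HardSphereFlow (Torus.geometry (Fin 3)) (hsDiameter σ N) (N + 1)) (ℓ : ℕ → ℝ), (∀ N, 0 < ℓ N ∧ ℓ N ≤ 1) → let K := fun (l : ℝ) (x y : T3) => indicator {y' : T3 | ∀ i, ‖y' i - x i‖ < l / 2} (fun _ => (l ^ 3)⁻¹) y; let Dn := fun N t z x => empiricalDensityField ((Φ N).flow t z) (K (ℓ N) x); let Mm := fun N t z x => empiricalMomentumField ((Φ N).flow t z) (K (ℓ N) x); let En := fun N t z x => empiricalEnergyField ((Φ N).flow t z) (K (ℓ N) x); let Sk := fun N t z x (i j : Fin 3) => ∫ y, K (ℓ N) x y.1 * (y.2 i * y.2 j) ∂(empiricalMeasure ((Φ N).flow t z)); let Th := fun (r : ℝ) (m : V3) (E : ℝ) => 2 / 3 * (E / r - ‖m‖ ^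 2 / (2 * r ^ 2)); let Zc := fun η : ℝ => hsCompressibility (min η η₁); let Pc := fun r ϑ : ℝ => r * ϑ * Zc (r * σ ^ 3); ∀ τ ∈ Ico 0 T, ∀ w : ℝ → T3 → V3, Torus.IsSmoothSpaceTimeOn (Ico 0 T) w → ∀ (N : ℕ), ∀ z ∈ (Φ N).good, IntegrableOn (fun t => ∫ x, (inner ℝ (Mm N t z x) (Torus.timeDerivWithin (Ico 0 T) w t x) + (∑ i, ∑ j, Mm N t z x i * Mm N t z x j / Dn N t z x * Torus.partialDeriv j (fun y => w t y i) x) + Pc (Dn N t z x) (Th (Dn N t z x) (Mm N t z x) (En N t z x)) * Torus.divergence (w t) x)) (Ioc 0 τ) ∧ IntegrableOn (fun t => ∫ x, Dn N t z x * Th (Dn N t z x) (Mm N t z x) (En N t z x) * (Zc (Dn N t z x * σ ^ 3) - 1) * Torus.divergence (w t) x) (Ioc 0 τ) ∧ IntegrableOn (fun t => ∫ x, ∑ i, ∑ j, (Sk N t z x i j - Mm N t z x i * Mm N t z x j / Dn N t z x - (if i = j then Dn N t z x * Th (Dn N t z x) (Mm N t z x) (En N t z x) else 0)) * Torus.partialDeriv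 j (fun y => w t y i) x) (Ioc 0 τ) := by
  intro σ η₁ T Φ ℓ hℓ
  dsimp only
  intro τ hτ w hw N z hz
  have hγ : Measurable fun t : ℝ => (Φ N).flow t z :=
    (Φ N).measurable_flow_prod_torus.comp
      ((measurable_const (a := (⟨z, hz⟩ : (Φ N).good))).prodMk measurable_id)
  exact integrableOn_boxFunctionals (γ := fun t => (Φ N).flow t z)
    (k := fun x y => indicator {y' : T3 | ∀ i, ‖y' i - x i‖ < ℓ N / 2} (fun _ => (ℓ N ^ 3)⁻¹) y)
    hγ (Real.sqrt_nonneg _) (fun t i => norm_vel_flow_le (Φ N) hz t i) (LGFS.measurable_boxK_uncurry (ℓ N))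
    (fun x y => LGFS.boxK_nonneg (hℓ N).1.le x y) (fun x y => LGFS.boxK_le (hℓ N).1.le x y)
    (fun x y => by simp only [Set.indicator]; split_ifs <;> simp) hτ.2 hw σ η₁

end FluxClosureB4
end Summit.AtomisticToContinuum.HydrodynamicLimit.Theorems
end
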